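import Literature.MathematicalPhysics.QuantumFieldTheory.Balaban1983to89.Beta.PolarizationSign
import Summits.QuantumFields.BalabanUV.Beta.KernelPermutation

/-!
# `BalabanUV.Beta.D1BFx.PermCovariantReynolds` — road «BF-x», binder row D1, Q-an2-g55-1 «TREE-DEPENDENCE OF THE EVALUATED LITERAL»:
# **THE S_d-REYNOLDS MEAN OF A KERNEL (OR OF A TRANSPORTING FAMILY) IS PERMUTATION-COVARIANT; THE PRINTED CLASSES AND (1.22) PASS TO THE MEAN**

For ANY lattice kernel `P : B12Beta.Kernel d` the axis permutation `σ` acts by relabelling sites and directions,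
`permAct σ P μ ν x := P (σ μ) (σ ν) (x ∘ σ⁻¹)` — the action in which the printed covariance (1.21) `B12Beta.PermCovariant P` reads
`∀ σ, permAct σ P = P` (`permCovariant_iff`).  The REYNOLDS SUM `reynolds P := Σ_σ permAct σ P` and MEAN `reynoldsMean P := (d!)⁻¹ · reynolds P`
are permutation-covariant for EVERY `P` (`permCovariant_reynolds`, `permCovariant_reynoldsMean`); a covariant kernel is its own mean
(`reynoldsMean_eq_self`).  A FAMILY `T : Equiv.Perm (Fin d) → Kernel d` obeying the TRANSPORT LAW `T (π * σ) (π μ) (π ν) (x ∘ π⁻¹) = T σ μ ν x`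
(«permuting the axes carries the σ-object to the (π∘σ)-object»; a HYPOTHESIS, displayed verbatim in each signature) sums to the Reynolds sum of
its member at `1` (`sum_family_eq_reynolds`), hence its sum and mean are covariant (`permCovariant_sum_family`, `permCovariant_mean_family`).  §3: the printed classes (5.9) `WardTransversal`, (5.7) `AxisReflectionCovariant`,
(5.8) `IndexSymmetric` are carried by `permAct σ`, finite sums and scalars (so by the mean of ANY family whose members have them), hence by
`reynoldsMean` (`wardTransversal_reynoldsMean`, …).  §4: (1.22) transports —
`secondMoment (permAct σ P) μ ν = secondMoment P (σ μ) (σ ν)` (no summability), `secondMoment (reynoldsMean P) μ ν = (d!)⁻¹ Σ_σ secondMoment P (σ μ) (σ ν)`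
(summable second moments), the mean's second moment is PAIR-INDEPENDENT (`B12Beta.secondMoment_pair_indep` BY NAME), and — the by-value reading
of a «pair-averaged hβ» — the pair sum of (1.22) over ordered pairs of distinct directions is Reynolds-invariant (`pairSum_secondMoment_reynoldsMean`), so
`#{(a,b): a ≠ b} · secondMoment (reynoldsMean P) μ ν = Σ_{a ≠ b} secondMoment P a b` for every `μ ≠ ν` (`card_pairs_mul_secondMoment_reynoldsMean`).

WHY (located, zero weight on rulings).  The chart-(III′) literal of record `CombChartJointEnd.JsB12CombShSym` is a ONE-COMB object (its resolvent
`GcombSh Lc j` is the relative inverse of the (0.4)-bordered step Hessian on ONE comb's coordinate slice, `RelInvCombShiftedSpread`); by this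
lineage's `CombPermutationWitness` an axis permutation carries the comb to ANOTHER comb, so the one-comb kernels form a family indexed by comb
orders which transports, and permutation covariance of one member is a TREE-INDEPENDENCE statement (open; Q-an2-g55-1 is its by-value face).
This file is the [folklore] algebra of the repair option (R1) of that witness («symmetrise over the `(d+1)!` axis orders») at KERNEL level:
WHATEVER the members are, the Reynolds mean is covariant, keeps (5.7)–(5.9), and its (1.22) is the average of the members' pair values.
It decides nothing about which literal the row wants; every class enters as a HYPOTHESIS on abstract kernels.  NOTE (design, located): the mean
is taken at KERNEL level — `ExpKernelCalculus.hessKer G (vertexOfK G N S) W` is quadratic in the first-order stencils and depends on the comb through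
`G`, so the mean of the one-comb kernels is NOT the kernel of averaged jets; a JetData-level «Reynolds literal» is a different object (the owner's call).

HONEST DEPENDENCY (cell records, verbatim): «continuum YM on T⁴ ⇐ BetaPertH ∧ nine spine estimates (0/9 proved); BetaPertH ⇐ (D1) ∧ (D4) ∧
CAP+tail; G-an2-4 gates asym, D1 and NE2/3/4.»  HONEST FRAMING (cell contract, verbatim): «discharging `BetaPertH` makes Bałaban's UV stability
UNCONDITIONAL — a real constructive-QFT result; it is NOT the continuum limit and NOT the Clay problem.»  THIS MODULE DISCHARGES NOTHING of the
wall: [folklore] finite-group averaging over `ℤ^d`-kernels (data defs `permAct`, `reynolds`, `reynoldsMean` = [our objects], names asserting nothing;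
the site relabelling is this lineage's `KernelPermutation.psite` BY NAME); 0 sorry, 0 `def … : Prop`, nothing cited, no binder of row D1 touched; NOT D1, NOT
`BetaPertH`, NOT continuum, NOT Clay.  Unit `b2b-balaban-beta-d1-formalise-leaf-01` (gen 37), 2026-08-25 (O-g37-1).
ABSOLUTE RULE (cell, verbatim): «No internally-minted statement may enter as a cited fact. Every hypothesis is either kernel-proved in this
package or a verbatim quotation of a PUBLISHED theorem with page reference.»
-/

namespace Summit.QuantumFields.BalabanUV.Beta.D1BFx.PermCovariantReynolds

open Literature.MathematicalPhysics.QuantumFieldTheory.Balaban1983to89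
open Literature.MathematicalPhysics.QuantumFieldTheory.Balaban1983to89.Beta.PolarizationSign
open Literature.MathematicalPhysics.QuantumFieldTheory.Balaban1983to89.B6BondElimination (unitVec unitVec_apply)
open Summit.QuantumFields.BalabanUV.Beta.KernelPermutation (psite psite_apply psite_symm_apply)
open Finset
open scoped BigOperators

variable {d : ℕ}

/-! ## §1 The action of an axis permutation on kernels; (1.21) as invariance -/

/-- [folklore] **THE AXIS-PERMUTATION ACTION ON KERNELS**: `permAct σ P μ ν x := P (σ μ) (σ ν) (x ∘ σ⁻¹)` — directions relabelled by `σ`,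
sites by `x ↦ x ∘ σ⁻¹` (the convention of `B12Beta.PermCovariant`). -/
def permAct (σ : Equiv.Perm (Fin d)) (P : B12Beta.Kernel d) : B12Beta.Kernel d := fun μ ν x => P (σ μ) (σ ν) (x ∘ ⇑σ.symm)

/-- [folklore] `permAct` unfolded. -/
@[simp] theorem permAct_apply (σ : Equiv.Perm (Fin d)) (P : B12Beta.Kernel d) (μ ν : Fin d) (x : Fin d → ℤ) :
    permAct σ P μ ν x = P (σ μ) (σ ν) (x ∘ ⇑σ.symm) := rfl
/-- [folklore] **(1.21) IS INVARIANCE UNDER THE ACTION**: `PermCovariant P ↔ ∀ σ, permAct σ P = P`. -/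
theorem permCovariant_iff (P : B12Beta.Kernel d) : B12Beta.PermCovariant P ↔ ∀ σ, permAct σ P = P := by
  constructor
  · intro h σ
    funext μ ν x
    exact h σ μ ν x
  · intro h σ μ ν x
    have := congrFun (congrFun (congrFun (h σ) μ) ν) x
    simpa only [permAct_apply] using this

/-- [folklore] The action is multiplicative (a right action in this convention): `permAct π (permAct σ P) = permAct (σ * π) P`. -/
theorem permAct_permAct (π σ : Equiv.Perm (Fin d)) (P : B12Beta.Kernel d) : permAct π (permAct σ P) = permAct (σ * π) P := by
  funext μ ν x
  simp only [permAct_apply, Equiv.Perm.mul_apply]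
  congr 1

/-- [folklore] The action commutes with finite sums of kernels. -/
theorem permAct_sum {ι : Type*} (s : Finset ι) (σ : Equiv.Perm (Fin d)) (P : ι → B12Beta.Kernel d) :
    permAct σ (∑ i ∈ s, P i) = ∑ i ∈ s, permAct σ (P i) := by
  funext μ ν x
  simp only [permAct_apply, Finset.sum_apply]

/-! ## §2 The Reynolds sum and mean; covariance for every kernel; transporting families -/

/-- [folklore] **THE REYNOLDS SUM** over the axis permutations: `reynolds P := Σ_σ permAct σ P`. -/
def reynolds (P : B12Beta.Kernel d) : B12Beta.Kernel d := ∑ σ : Equiv.Perm (Fin d), permAct σ P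

/-- [folklore] Entries of the Reynolds sum. -/
theorem reynolds_apply (P : B12Beta.Kernel d) (μ ν : Fin d) (x : Fin d → ℤ) :
    reynolds P μ ν x = ∑ σ : Equiv.Perm (Fin d), P (σ μ) (σ ν) (x ∘ ⇑σ.symm) := by
  simp only [reynolds, Finset.sum_apply, permAct_apply]

/-- [folklore] **THE REYNOLDS SUM IS PERMUTATION-COVARIANT, FOR EVERY KERNEL** (re-index the group by right multiplication). -/
theorem permCovariant_reynolds (P : B12Beta.Kernel d) : B12Beta.PermCovariant (reynolds P) := by
  rw [permCovariant_iff]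
  intro π
  rw [reynolds, permAct_sum]
  simp_rw [permAct_permAct]
  exact Equiv.sum_comp (Equiv.mulRight π) (fun τ => permAct τ P)

/-- [folklore] **THE REYNOLDS MEAN** `reynoldsMean P := (#S_d)⁻¹ • reynolds P` (`#S_d = d!`, `Fintype.card_perm`). -/
noncomputable def reynoldsMean (P : B12Beta.Kernel d) : B12Beta.Kernel d :=
  ((Fintype.card (Equiv.Perm (Fin d)) : ℝ))⁻¹ • reynolds P

/-- [folklore] A scalar multiple of a covariant kernel is covariant. -/
theorem permCovariant_smul {P : B12Beta.Kernel d} (h : B12Beta.PermCovariant P) (c : ℝ) : B12Beta.PermCovariant (c • P) := by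
  intro σ μ ν x
  simp only [Pi.smul_apply, smul_eq_mul, h σ μ ν x]

/-- [folklore] **THE REYNOLDS MEAN IS PERMUTATION-COVARIANT, FOR EVERY KERNEL.** -/
theorem permCovariant_reynoldsMean (P : B12Beta.Kernel d) : B12Beta.PermCovariant (reynoldsMean P) :=
  permCovariant_smul (permCovariant_reynolds P) _

/-- [folklore] The Reynolds sum of a COVARIANT kernel is `#S_d` copies of it. -/
theorem reynolds_eq_smul_self {P : B12Beta.Kernel d} (h : B12Beta.PermCovariant P) :
    reynolds P = ((Fintype.card (Equiv.Perm (Fin d)) : ℝ)) • P := by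
  funext μ ν x
  rw [reynolds_apply, Finset.sum_congr rfl fun σ _ => h σ μ ν x, Finset.sum_const, Finset.card_univ, nsmul_eq_mul]
  rfl

/-- [folklore] **A COVARIANT KERNEL IS ITS OWN REYNOLDS MEAN.** -/
theorem reynoldsMean_eq_self {P : B12Beta.Kernel d} (h : B12Beta.PermCovariant P) : reynoldsMean P = P := by
  have hc : ((Fintype.card (Equiv.Perm (Fin d)) : ℝ)) ≠ 0 := Nat.cast_ne_zero.mpr Fintype.card_ne_zero
  rw [reynoldsMean, reynolds_eq_smul_self h, smul_smul, inv_mul_cancel₀ hc, one_smul]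

/-! ### Families indexed by axis orders — TRANSPORT LAW = the HYPOTHESIS `hT : ∀ π σ μ ν x, T (π * σ) (π μ) (π ν) (x ∘ π⁻¹) = T σ μ ν x`
(permuting the axes carries the `σ`-member to the `(π * σ)`-member; for one-comb kernels this is transport of structure; asserted of no typed family). -/

/-- [folklore] Under the transport law every member is the relabelled unit member: `T σ = permAct σ⁻¹ (T 1)`. -/
theorem member_eq_permAct_of_transports {T : Equiv.Perm (Fin d) → B12Beta.Kernel d}
    (hT : ∀ π σ μ ν x, T (π * σ) (π μ) (π ν) (x ∘ ⇑π.symm) = T σ μ ν x) (σ : Equiv.Perm (Fin d)) :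
    T σ = permAct σ⁻¹ (T 1) := by
  funext μ ν x
  have h := hT σ 1 (σ.symm μ) (σ.symm ν) (x ∘ ⇑σ)
  rw [mul_one, Equiv.apply_symm_apply, Equiv.apply_symm_apply] at h
  have hx : (x ∘ ⇑σ) ∘ ⇑σ.symm = x := by
    funext i; simp only [Function.comp_apply, Equiv.apply_symm_apply]
  rw [hx] at h
  rw [h, permAct_apply, Equiv.Perm.inv_def, Equiv.symm_symm]

/-- [folklore] **A TRANSPORTING FAMILY SUMS TO THE REYNOLDS SUM OF ITS UNIT MEMBER**: `Σ_σ T σ = reynolds (T 1)`. -/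
theorem sum_family_eq_reynolds {T : Equiv.Perm (Fin d) → B12Beta.Kernel d}
    (hT : ∀ π σ μ ν x, T (π * σ) (π μ) (π ν) (x ∘ ⇑π.symm) = T σ μ ν x) :
    ∑ σ : Equiv.Perm (Fin d), T σ = reynolds (T 1) := by
  rw [reynolds, Finset.sum_congr rfl fun σ _ => member_eq_permAct_of_transports hT σ]
  exact Equiv.sum_comp (Equiv.inv (Equiv.Perm (Fin d))) (fun τ => permAct τ (T 1))

/-- [folklore] **THE SUM OF A TRANSPORTING FAMILY IS PERMUTATION-COVARIANT.** -/
theorem permCovariant_sum_family {T : Equiv.Perm (Fin d) → B12Beta.Kernel d}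
    (hT : ∀ π σ μ ν x, T (π * σ) (π μ) (π ν) (x ∘ ⇑π.symm) = T σ μ ν x) :
    B12Beta.PermCovariant (∑ σ : Equiv.Perm (Fin d), T σ) := by
  rw [sum_family_eq_reynolds hT]
  exact permCovariant_reynolds _

/-- [folklore] **THE MEAN OF A TRANSPORTING FAMILY IS PERMUTATION-COVARIANT** (and equals `reynoldsMean (T 1)`). -/
theorem permCovariant_mean_family {T : Equiv.Perm (Fin d) → B12Beta.Kernel d}
    (hT : ∀ π σ μ ν x, T (π * σ) (π μ) (π ν) (x ∘ ⇑π.symm) = T σ μ ν x) :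
    B12Beta.PermCovariant (((Fintype.card (Equiv.Perm (Fin d)) : ℝ))⁻¹ • ∑ σ : Equiv.Perm (Fin d), T σ) := by
  rw [sum_family_eq_reynolds hT]
  exact permCovariant_reynoldsMean _

/-! ## §3 The printed classes (5.7)–(5.9) pass to relabelled kernels, finite sums, and the Reynolds mean -/

/-- [folklore] Relabelling a unit vector: `e_μ ∘ σ⁻¹ = e_{σ μ}`. -/
theorem unitVec_comp_symm (σ : Equiv.Perm (Fin d)) (μ : Fin d) : (unitVec μ ∘ ⇑σ.symm : Fin d → ℤ) = unitVec (σ μ) := by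
  funext i
  show unitVec μ (σ.symm i) = unitVec (σ μ) i
  rw [unitVec_apply, unitVec_apply]
  by_cases h : i = σ μ
  · rw [if_pos h, if_pos (by rw [h, Equiv.symm_apply_apply])]
  · rw [if_neg h, if_neg (fun hc => h (by rw [← hc, Equiv.apply_symm_apply]))]

/-- [folklore] Relabelling a one-axis reflection: `(ε_α z) ∘ σ⁻¹ = ε_{σ α} (z ∘ σ⁻¹)`. -/
theorem axisReflect_comp_symm (σ : Equiv.Perm (Fin d)) (α : Fin d) (z : Fin d → ℤ) :
    (axisReflect α z ∘ ⇑σ.symm : Fin d → ℤ) = axisReflect (σ α) (z ∘ ⇑σ.symm) := by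
  funext i
  show axisReflect α z (σ.symm i) = axisReflect (σ α) (z ∘ ⇑σ.symm) i
  rw [axisReflect_apply, axisReflect_apply, Function.comp_apply]
  by_cases h : i = σ α
  · rw [if_pos h, if_pos (by rw [h, Equiv.symm_apply_apply])]
  · rw [if_neg h, if_neg (fun hc => h (by rw [← hc, Equiv.apply_symm_apply]))]

/-- [folklore] Relabelled reflection signs: `ε_{σα, σμ} = ε_{α, μ}`. -/
theorem reflSign_perm (σ : Equiv.Perm (Fin d)) (α μ : Fin d) : reflSign (σ α) (σ μ) = reflSign α μ := by
  simp only [reflSign, σ.injective.eq_iff]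

/-- [folklore] **(5.9) PASSES TO RELABELLED KERNELS.** -/
theorem wardTransversal_permAct {P : B12Beta.Kernel d} (h : WardTransversal P) (σ : Equiv.Perm (Fin d)) : WardTransversal (permAct σ P) := by
  intro ν z
  have e : ∀ μ, permAct σ P μ ν (z - unitVec μ) - permAct σ P μ ν z =
      P (σ μ) (σ ν) (z ∘ ⇑σ.symm - unitVec (σ μ)) - P (σ μ) (σ ν) (z ∘ ⇑σ.symm) := by
    intro μ
    simp only [permAct_apply]
    rw [← unitVec_comp_symm σ μ]
    rfl
  simp_rw [e]
  rw [Equiv.sum_comp σ (fun μ' => P μ' (σ ν) (z ∘ ⇑σ.symm - unitVec μ') - P μ' (σ ν) (z ∘ ⇑σ.symm))]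
  exact h (σ ν) (z ∘ ⇑σ.symm)

/-- [folklore] **(5.7) PASSES TO RELABELLED KERNELS.** -/
theorem axisReflectionCovariant_permAct {P : B12Beta.Kernel d} (h : AxisReflectionCovariant P) (σ : Equiv.Perm (Fin d)) :
    AxisReflectionCovariant (permAct σ P) := by
  intro α μ ν z
  simp only [permAct_apply]
  have hz : ((axisReflect α z - (if μ = α then unitVec α else 0) + (if ν = α then unitVec α else 0)) ∘ ⇑σ.symm : Fin d → ℤ) =
      axisReflect (σ α) (z ∘ ⇑σ.symm) - (if σ μ = σ α then unitVec (σ α) else 0) + (if σ ν = σ α then unitVec (σ α) else 0) := by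
    rw [← axisReflect_comp_symm, ← unitVec_comp_symm σ α]
    simp only [σ.injective.eq_iff]
    funext i
    by_cases hμ : μ = α <;> by_cases hν : ν = α <;> simp [hμ, hν]
  rw [hz, h (σ α) (σ μ) (σ ν) (z ∘ ⇑σ.symm), reflSign_perm, reflSign_perm]

/-- [folklore] **(5.8) PASSES TO RELABELLED KERNELS.** -/
theorem indexSymmetric_permAct {P : B12Beta.Kernel d} (h : IndexSymmetric P) (σ : Equiv.Perm (Fin d)) : IndexSymmetric (permAct σ P) := by
  intro μ ν x
  simp only [permAct_apply]
  rw [h (σ μ) (σ ν)]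
  rfl

/-- [folklore] (5.9) passes to finite sums of kernels. -/
theorem wardTransversal_sum {ι : Type*} (s : Finset ι) {P : ι → B12Beta.Kernel d} (h : ∀ i ∈ s, WardTransversal (P i)) :
    WardTransversal (∑ i ∈ s, P i) := by
  intro ν z
  simp only [Finset.sum_apply, ← Finset.sum_sub_distrib]
  rw [Finset.sum_comm]
  exact Finset.sum_eq_zero fun i hi => h i hi ν z

/-- [folklore] (5.7) passes to finite sums of kernels. -/
theorem axisReflectionCovariant_sum {ι : Type*} (s : Finset ι) {P : ι → B12Beta.Kernel d} (h : ∀ i ∈ s, AxisReflectionCovariant (P i)) :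
    AxisReflectionCovariant (∑ i ∈ s, P i) := by
  intro α μ ν z
  simp only [Finset.sum_apply, Finset.mul_sum]
  exact Finset.sum_congr rfl fun i hi => h i hi α μ ν z

/-- [folklore] (5.8) passes to finite sums of kernels. -/
theorem indexSymmetric_sum {ι : Type*} (s : Finset ι) {P : ι → B12Beta.Kernel d} (h : ∀ i ∈ s, IndexSymmetric (P i)) :
    IndexSymmetric (∑ i ∈ s, P i) := by
  intro μ ν x
  simp only [Finset.sum_apply]
  exact Finset.sum_congr rfl fun i hi => h i hi μ ν x

/-- [folklore] (5.9) passes to scalar multiples. -/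
theorem wardTransversal_smul {P : B12Beta.Kernel d} (h : WardTransversal P) (c : ℝ) : WardTransversal (c • P) := by
  intro ν z
  simp only [Pi.smul_apply, smul_eq_mul, ← Finset.mul_sum, ← mul_sub, h ν z, mul_zero]

/-- [folklore] (5.7) passes to scalar multiples. -/
theorem axisReflectionCovariant_smul {P : B12Beta.Kernel d} (h : AxisReflectionCovariant P) (c : ℝ) : AxisReflectionCovariant (c • P) := by
  intro α μ ν z
  simp only [Pi.smul_apply, smul_eq_mul, h α μ ν z]
  ring

/-- [folklore] (5.8) passes to scalar multiples. -/
theorem indexSymmetric_smul {P : B12Beta.Kernel d} (h : IndexSymmetric P) (c : ℝ) : IndexSymmetric (c • P) := by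
  intro μ ν x
  simp only [Pi.smul_apply, smul_eq_mul, h μ ν x]

/-- [folklore] **(5.9) PASSES TO THE REYNOLDS MEAN.** -/
theorem wardTransversal_reynoldsMean {P : B12Beta.Kernel d} (h : WardTransversal P) : WardTransversal (reynoldsMean P) :=
  wardTransversal_smul (wardTransversal_sum _ fun σ _ => wardTransversal_permAct h σ) _

/-- [folklore] **(5.7) PASSES TO THE REYNOLDS MEAN.** -/
theorem axisReflectionCovariant_reynoldsMean {P : B12Beta.Kernel d} (h : AxisReflectionCovariant P) :
    AxisReflectionCovariant (reynoldsMean P) :=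
  axisReflectionCovariant_smul (axisReflectionCovariant_sum _ fun σ _ => axisReflectionCovariant_permAct h σ) _

/-- [folklore] **(5.8) PASSES TO THE REYNOLDS MEAN.** -/
theorem indexSymmetric_reynoldsMean {P : B12Beta.Kernel d} (h : IndexSymmetric P) : IndexSymmetric (reynoldsMean P) :=
  indexSymmetric_smul (indexSymmetric_sum _ fun σ _ => indexSymmetric_permAct h σ) _

/-! ## §4 (1.22) under relabelling and under the mean; pair-independence of the mean's second moment -/

/-- [folklore] **(1.22) TRANSPORTS**: `secondMoment (permAct σ P) μ ν = secondMoment P (σ μ) (σ ν)` (re-indexing the lattice sum by the automorphism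
`x ↦ x ∘ σ⁻¹`; no summability needed). -/
theorem secondMoment_permAct (σ : Equiv.Perm (Fin d)) (P : B12Beta.Kernel d) (μ ν : Fin d) :
    B12Beta.secondMoment (permAct σ P) μ ν = B12Beta.secondMoment P (σ μ) (σ ν) := by
  unfold B12Beta.secondMoment
  rw [← (psite (β := ℤ) σ).symm.tsum_eq (fun x => permAct σ P μ ν x * (x μ : ℝ) * (x ν : ℝ))]
  refine tsum_congr fun y => ?_
  have hy : ((psite (β := ℤ) σ).symm y ∘ ⇑σ.symm : Fin d → ℤ) = y := by
    funext i; simp only [Function.comp_apply, psite_symm_apply, Equiv.apply_symm_apply]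
  simp only [permAct_apply, hy, psite_symm_apply]

/-- [folklore] (1.22) of a scalar multiple. -/
theorem secondMoment_smul (c : ℝ) (P : B12Beta.Kernel d) (μ ν : Fin d) :
    B12Beta.secondMoment (c • P) μ ν = c * B12Beta.secondMoment P μ ν := by
  unfold B12Beta.secondMoment
  rw [← tsum_mul_left]
  exact tsum_congr fun x => by simp only [Pi.smul_apply, smul_eq_mul]; ring

/-- [folklore] (1.22) of a finite sum of kernels with summable second moments. -/
theorem secondMoment_sum {ι : Type*} (s : Finset ι) (P : ι → B12Beta.Kernel d) (μ ν : Fin d)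
    (hs : ∀ i ∈ s, Summable fun x : Fin d → ℤ => P i μ ν x * (x μ : ℝ) * (x ν : ℝ)) :
    B12Beta.secondMoment (∑ i ∈ s, P i) μ ν = ∑ i ∈ s, B12Beta.secondMoment (P i) μ ν := by
  unfold B12Beta.secondMoment
  rw [← Summable.tsum_finsetSum hs]
  exact tsum_congr fun x => by simp only [Finset.sum_apply, Finset.sum_mul]

/-- [folklore] Summable second moments transport under relabelling. -/
theorem summable_secondMoment_permAct {P : B12Beta.Kernel d} (hs : ∀ μ ν, Summable fun x : Fin d → ℤ => P μ ν x * (x μ : ℝ) * (x ν : ℝ))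
    (σ : Equiv.Perm (Fin d)) (μ ν : Fin d) : Summable fun x : Fin d → ℤ => permAct σ P μ ν x * (x μ : ℝ) * (x ν : ℝ) := by
  have h := ((psite (β := ℤ) σ).summable_iff).mpr (hs (σ μ) (σ ν))
  refine h.congr fun x => ?_
  have h1 : psite (β := ℤ) σ x (σ μ) = x μ := by rw [psite_apply, Equiv.symm_apply_apply]
  have h2 : psite (β := ℤ) σ x (σ ν) = x ν := by rw [psite_apply, Equiv.symm_apply_apply]
  simp only [Function.comp_apply, permAct_apply, h1, h2]
  rfl

/-- [folklore] **(1.22) OF THE REYNOLDS MEAN IS THE AVERAGE OF THE RELABELLED PAIR VALUES**: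
`secondMoment (reynoldsMean P) μ ν = (#S_d)⁻¹ Σ_σ secondMoment P (σ μ) (σ ν)` (summable second moments). -/
theorem secondMoment_reynoldsMean {P : B12Beta.Kernel d} (hs : ∀ μ ν, Summable fun x : Fin d → ℤ => P μ ν x * (x μ : ℝ) * (x ν : ℝ))
    (μ ν : Fin d) :
    B12Beta.secondMoment (reynoldsMean P) μ ν =
      ((Fintype.card (Equiv.Perm (Fin d)) : ℝ))⁻¹ * ∑ σ : Equiv.Perm (Fin d), B12Beta.secondMoment P (σ μ) (σ ν) := by
  rw [reynoldsMean, secondMoment_smul, reynolds, secondMoment_sum _ _ μ ν fun σ _ => summable_secondMoment_permAct hs σ μ ν]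
  simp_rw [secondMoment_permAct]

/-- [folklore] **THE MEAN's (1.22) IS PAIR-INDEPENDENT** — the printed clause «for μ, ν arbitrary, μ ≠ ν» holds for the Reynolds mean of ANY kernel
(`B12Beta.secondMoment_pair_indep` BY NAME at `permCovariant_reynoldsMean`). -/
theorem secondMoment_reynoldsMean_pair_indep (P : B12Beta.Kernel d) {μ ν μ' ν' : Fin d} (h : μ ≠ ν) (h' : μ' ≠ ν') :
    B12Beta.secondMoment (reynoldsMean P) μ' ν' = B12Beta.secondMoment (reynoldsMean P) μ ν :=
  B12Beta.secondMoment_pair_indep (permCovariant_reynoldsMean P) h h'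

/-- [folklore] The same for the mean of a transporting family. -/
theorem secondMoment_mean_family_pair_indep {T : Equiv.Perm (Fin d) → B12Beta.Kernel d}
    (hT : ∀ π σ μ ν x, T (π * σ) (π μ) (π ν) (x ∘ ⇑π.symm) = T σ μ ν x) {μ ν μ' ν' : Fin d} (h : μ ≠ ν) (h' : μ' ≠ ν') :
    B12Beta.secondMoment (((Fintype.card (Equiv.Perm (Fin d)) : ℝ))⁻¹ • ∑ σ : Equiv.Perm (Fin d), T σ) μ' ν' =
      B12Beta.secondMoment (((Fintype.card (Equiv.Perm (Fin d)) : ℝ))⁻¹ • ∑ σ : Equiv.Perm (Fin d), T σ) μ ν :=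
  B12Beta.secondMoment_pair_indep (permCovariant_mean_family hT) h h'

/-! ### The pair average (the by-value reading of (E): the mean's (1.22) at ANY pair is the average of the kernel's (1.22) over all ordered pairs of distinct directions) -/

/-- [folklore] The sum of (1.22) over the ordered pairs of DISTINCT directions is invariant under relabelling by `σ`. -/
theorem pairSum_secondMoment_perm (σ : Equiv.Perm (Fin d)) (Q : B12Beta.Kernel d) :
    (∑ a : Fin d, ∑ b : Fin d, if a = b then (0 : ℝ) else B12Beta.secondMoment Q (σ a) (σ b)) =
      ∑ a : Fin d, ∑ b : Fin d, if a = b then (0 : ℝ) else B12Beta.secondMoment Q a b := by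
  have h1 : ∀ a : Fin d, (∑ b : Fin d, if a = b then (0 : ℝ) else B12Beta.secondMoment Q (σ a) (σ b)) =
      ∑ b : Fin d, if σ a = b then (0 : ℝ) else B12Beta.secondMoment Q (σ a) b := by
    intro a
    rw [← Equiv.sum_comp σ (fun b => if σ a = b then (0 : ℝ) else B12Beta.secondMoment Q (σ a) b)]
    refine Finset.sum_congr rfl fun b _ => ?_
    simp only [σ.injective.eq_iff]
  simp_rw [h1]
  exact Equiv.sum_comp σ (fun a' => ∑ b : Fin d, if a' = b then (0 : ℝ) else B12Beta.secondMoment Q a' b)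

/-- [folklore] **THE PAIR SUM OF (1.22) IS REYNOLDS-INVARIANT**: `Σ_{a ≠ b} secondMoment (reynoldsMean P) a b = Σ_{a ≠ b} secondMoment P a b`
(summable second moments). -/
theorem pairSum_secondMoment_reynoldsMean {P : B12Beta.Kernel d}
    (hs : ∀ μ ν, Summable fun x : Fin d → ℤ => P μ ν x * (x μ : ℝ) * (x ν : ℝ)) :
    (∑ a : Fin d, ∑ b : Fin d, if a = b then (0 : ℝ) else B12Beta.secondMoment (reynoldsMean P) a b) =
      ∑ a : Fin d, ∑ b : Fin d, if a = b then (0 : ℝ) else B12Beta.secondMoment P a b := by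
  have hc : ((Fintype.card (Equiv.Perm (Fin d)) : ℝ)) ≠ 0 := Nat.cast_ne_zero.mpr Fintype.card_ne_zero
  set c : ℝ := (Fintype.card (Equiv.Perm (Fin d)) : ℝ) with hcdef
  have e : ∀ a b : Fin d, (if a = b then (0 : ℝ) else B12Beta.secondMoment (reynoldsMean P) a b) =
      c⁻¹ * ∑ σ : Equiv.Perm (Fin d), (if a = b then (0 : ℝ) else B12Beta.secondMoment P (σ a) (σ b)) := by
    intro a b
    by_cases h : a = b
    · simp [h]
    · rw [if_neg h, secondMoment_reynoldsMean hs]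
      refine congrArg (c⁻¹ * ·) (Finset.sum_congr rfl fun σ _ => ?_)
      rw [if_neg h]
  calc (∑ a : Fin d, ∑ b : Fin d, if a = b then (0 : ℝ) else B12Beta.secondMoment (reynoldsMean P) a b)
      = ∑ a : Fin d, ∑ b : Fin d, c⁻¹ * ∑ σ : Equiv.Perm (Fin d), (if a = b then (0 : ℝ) else B12Beta.secondMoment P (σ a) (σ b)) :=
        Finset.sum_congr rfl fun a _ => Finset.sum_congr rfl fun b _ => e a b
    _ = c⁻¹ * ∑ a : Fin d, ∑ b : Fin d, ∑ σ : Equiv.Perm (Fin d), (if a = b then (0 : ℝ) else B12Beta.secondMoment P (σ a) (σ b)) := by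
        rw [Finset.mul_sum]
        refine Finset.sum_congr rfl fun a _ => ?_
        rw [Finset.mul_sum]
    _ = c⁻¹ * ∑ σ : Equiv.Perm (Fin d), ∑ a : Fin d, ∑ b : Fin d, (if a = b then (0 : ℝ) else B12Beta.secondMoment P (σ a) (σ b)) := by
        congr 1
        calc (∑ a : Fin d, ∑ b : Fin d, ∑ σ : Equiv.Perm (Fin d), (if a = b then (0 : ℝ) else B12Beta.secondMoment P (σ a) (σ b)))
            = ∑ a : Fin d, ∑ σ : Equiv.Perm (Fin d), ∑ b : Fin d, (if a = b then (0 : ℝ) else B12Beta.secondMoment P (σ a) (σ b)) :=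
              Finset.sum_congr rfl fun a _ => Finset.sum_comm
          _ = ∑ σ : Equiv.Perm (Fin d), ∑ a : Fin d, ∑ b : Fin d, (if a = b then (0 : ℝ) else B12Beta.secondMoment P (σ a) (σ b)) :=
              Finset.sum_comm
    _ = c⁻¹ * ∑ σ : Equiv.Perm (Fin d), ∑ a : Fin d, ∑ b : Fin d, (if a = b then (0 : ℝ) else B12Beta.secondMoment P a b) := by
        congr 1
        exact Finset.sum_congr rfl fun σ _ => pairSum_secondMoment_perm σ P
    _ = ∑ a : Fin d, ∑ b : Fin d, if a = b then (0 : ℝ) else B12Beta.secondMoment P a b := by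
        rw [Finset.sum_const, Finset.card_univ, nsmul_eq_mul, ← mul_assoc, ← hcdef, inv_mul_cancel₀ hc, one_mul]

/-- [folklore] **THE MEAN's (1.22) AT ANY PAIR IS THE PAIR AVERAGE OF THE KERNEL's (1.22)**: for `μ ≠ ν`,
`#{(a,b) : a ≠ b} · secondMoment (reynoldsMean P) μ ν = Σ_{a ≠ b} secondMoment P a b` (summable second moments) — the by-value content of a
«pair-averaged `hβ`»: identifying β⁰ with the Reynolds mean's second moment at one pair = identifying it with the average of the one-comb kernel's
second moments over the `d(d−1)` ordered pairs. -/
theorem card_pairs_mul_secondMoment_reynoldsMean {P : B12Beta.Kernel d}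
    (hs : ∀ μ ν, Summable fun x : Fin d → ℤ => P μ ν x * (x μ : ℝ) * (x ν : ℝ)) {μ ν : Fin d} (hμν : μ ≠ ν) :
    (∑ a : Fin d, ∑ b : Fin d, if a = b then (0 : ℝ) else 1) * B12Beta.secondMoment (reynoldsMean P) μ ν =
      ∑ a : Fin d, ∑ b : Fin d, if a = b then (0 : ℝ) else B12Beta.secondMoment P a b := by
  rw [← pairSum_secondMoment_reynoldsMean hs, Finset.sum_mul]
  refine Finset.sum_congr rfl fun a _ => ?_
  rw [Finset.sum_mul]
  refine Finset.sum_congr rfl fun b _ => ?_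
  by_cases h : a = b
  · simp [h]
  · rw [if_neg h, if_neg h, one_mul, secondMoment_reynoldsMean_pair_indep P hμν h]

end Summit.QuantumFields.BalabanUV.Beta.D1BFx.PermCovariantReynolds
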